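import Literature.AlgebraicGeometry.Resolution.AffineBlowupAlgebra
import HarnessLib

/-!
# The chart ring `(R[It])_{(bt)}` read in a field through `sec : R → K` — auxiliary algebra

Auxiliary lemmas for `stub_datumBlowupStalk` (crux `SyzygyFlattening.Globalisation`,
stmt-ResolutionOfSingularities-17061, line `birth`; main file
`SyzygyFlatteningGlobalisationDatumBlowupStalk.lean`), none of which mentions schemes. For an
ideal `I ⊆ R`, `b ∈ I`, the chart ring `C_b = (R[It])_{(bt)}` of the blowing up `Proj R[It]`
(`HomogeneousLocalization.Away (reesGrading I) (reesT b hb)`, `AffineBlowup.lean`; Stacks 0804: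
the affine blowup algebra `R[I/b]`) and a ring map `ψ : C_b → K` to a field extending a given
`sec : R → K` (`ψ (r/1) = sec r`) with `sec b ≠ 0`:

* `datumStalk_awayMk_mul_pow` — `(x/(bt)ᵐ) · (b/1)ᵐ = r/1` in `C_b` for `x = r tᵐ`
  (injectivity of the chart map `C_b → R[1/b]`, `reesChart_injective`);
* `datumStalk_apply_awayMk_mul_pow` — hence `ψ(x/(bt)ᵐ) · (sec b)ᵐ = sec r`;
* `datumStalk_mul_inv_pow_mem` — `sec r · (sec b)⁻ᵐ`, `r ∈ Iᵐ`, lies in every subring containing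
  `sec R` and the `sec n · (sec b)⁻¹`, `n ∈ I`;
* `datumStalk_range_eq_adjoin` — **the image of `ψ` is `k[sec R, sec N / sec b]`**: the
  `k`-subalgebra of `K` generated by `sec R` and the `sec n · (sec b)⁻¹` (`k ⊆ sec R`), i.e. the
  blow-up chart `A[I/b]` of `A = sec R` inside `K` (Görtz–Wedhorn (13.19), p. 415: `A[I/f] ⊆ A_f`
  is generated by the `x/f`).

Sources: The Stacks Project, Tag 0804 and Tag 052Q (affine blowup algebras); U. Görtz,
T. Wedhorn, *Algebraic Geometry I*, 2nd ed. (2020), (13.19), p. 415.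
-/

noncomputable section

-- single-problem summit: the doubled namespace component `ResolutionOfSingularities` is forced
set_option linter.dupNamespace false

namespace Summit.ResolutionOfSingularities.ResolutionOfSingularities.Theorems.SyzygyFlattening

open Polynomial HomogeneousLocalization Literature.AlgebraicGeometry.Resolution

variable {R : Type*} [CommRing R] {I : Ideal R} (b : R) (hb : b ∈ I)

/-- **`(x/(bt)ᵐ) · (b/1)ᵐ = r/1` in the chart ring `(R[It])_{(bt)}`** for `x = r tᵐ ∈ Iᵐtᵐ`
(both sides have the same image `r` under the injective chart map to `R[1/b]`).
[cite: StacksProject, Tag 0804] -/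
theorem datumStalk_awayMk_mul_pow {m : ℕ} {x : reesAlgebra I} (hx : x ∈ reesGrading I (m • 1))
    {r : R} (hr : (x : R[X]) = monomial m r) :
    HomogeneousLocalization.Away.mk (reesGrading I) (reesT_mem b hb) m x hx *
        reesChartBase b hb b ^ m = reesChartBase b hb r := by
  apply reesChart_injective b hb
  rw [map_mul, RingHom.map_pow, reesChart_reesChartBase, reesChart_reesChartBase, reesChart_mk b hb hx hr,
    mul_assoc, ← mul_pow, mul_comm (IsLocalization.Away.invSelf b), IsLocalization.Away.mul_invSelf,
    one_pow, mul_one]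

/-- A ring map `ψ` out of the chart ring with `ψ (r/1) = sec r` satisfies
`ψ(x/(bt)ᵐ) · (sec b)ᵐ = sec r` for `x = r tᵐ`. [folklore] -/
theorem datumStalk_apply_awayMk_mul_pow {L : Type*} [CommRing L] (sec : R →+* L)
    (ψ : HomogeneousLocalization.Away (reesGrading I) (reesT b hb) →+* L)
    (hψ : ∀ r, ψ (reesChartBase b hb r) = sec r) {m : ℕ} {x : reesAlgebra I}
    (hx : x ∈ reesGrading I (m • 1)) {r : R} (hr : (x : R[X]) = monomial m r) :
    ψ (HomogeneousLocalization.Away.mk (reesGrading I) (reesT_mem b hb) m x hx) * sec b ^ m =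
      sec r := by
  rw [← hψ, ← hψ, ← RingHom.map_pow, ← map_mul, datumStalk_awayMk_mul_pow b hb hx hr]

/-- For `r ∈ Iᵐ`, `sec r · ((sec b)⁻¹)ᵐ` lies in every subring of the field `K` containing `sec R`
and the ratios `sec n · (sec b)⁻¹`, `n ∈ I` (`r` is a sum of products of `m` elements of `I`).
[folklore] -/
theorem datumStalk_mul_inv_pow_mem {K : Type*} [Field K] (sec : R →+* K) (T : Subring K)
    (hT : Set.range sec ⊆ T) (hTb : ∀ n ∈ I, sec n * (sec b)⁻¹ ∈ T) :
    ∀ (m : ℕ) {r : R}, r ∈ I ^ m → sec r * (sec b)⁻¹ ^ m ∈ T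
  | 0, r, _ => by
    rw [pow_zero, mul_one]
    exact hT ⟨r, rfl⟩
  | m + 1, r, hr => by
    rw [pow_succ] at hr
    refine Submodule.mul_induction_on hr (fun s hs t ht => ?_) (fun x y hx hy => ?_)
    · rw [map_mul, pow_succ, mul_mul_mul_comm]
      exact T.mul_mem (datumStalk_mul_inv_pow_mem sec T hT hTb m hs) (hTb t ht)
    · rw [map_add, add_mul]
      exact T.add_mem hx hy

/-- **The image in `K` of the chart ring is the blow-up chart `k[sec R, sec I / sec b]`.** For a
ring map `ψ : (R[It])_{(bt)} → K` to a field with `ψ (r/1) = sec r`, `sec b ≠ 0` and `k ⊆ sec R`: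
`im ψ = k[sec R ∪ {sec n · (sec b)⁻¹ | n ∈ I}]` — `⊆` since `ψ(x/(bt)ᵐ) = sec r · (sec b)⁻ᵐ` for
`x = r tᵐ`, `r ∈ Iᵐ` (`datumStalk_mul_inv_pow_mem`), `⊇` since `sec r = ψ(r/1)` and
`sec n · (sec b)⁻¹ = ψ((nt)/(bt))` (Görtz–Wedhorn (13.19): `A[I/f]` is generated by the `x/f`).
[cite: GortzWedhorn2020, (13.19) p. 415] -/
theorem datumStalk_range_eq_adjoin {k K : Type*} [Field k] [Field K] [Algebra k K]
    (sec : R →+* K) (hb0 : sec b ≠ 0) (hk : ∀ c : k, algebraMap k K c ∈ Set.range sec)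
    (ψ : HomogeneousLocalization.Away (reesGrading I) (reesT b hb) →+* K)
    (hψ : ∀ r, ψ (reesChartBase b hb r) = sec r) :
    Set.range ψ =
      (Algebra.adjoin k (Set.range sec ∪ {y : K | ∃ n ∈ I, y = sec n * (sec b)⁻¹}) : Set K) := by
  apply Set.Subset.antisymm
  · rintro _ ⟨d, rfl⟩
    obtain ⟨m, x, hx, rfl⟩ :=
      HomogeneousLocalization.Away.mk_surjective (reesGrading I) (reesT_mem b hb) d
    obtain ⟨r, hr⟩ := (mem_reesGrading_iff I).mp hx
    have hm : (m • 1 : ℕ) = m := by simp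
    have hr' : (x : R[X]) = monomial m r := by rw [← hr, hm]
    have hrI : r ∈ I ^ m := by
      have := x.2
      rw [hr', reesAlgebra.monomial_mem] at this
      exact this
    have key := datumStalk_apply_awayMk_mul_pow b hb sec ψ hψ hx hr'
    have hval : ψ (HomogeneousLocalization.Away.mk (reesGrading I) (reesT_mem b hb) m x hx) =
        sec r * (sec b)⁻¹ ^ m := by
      rw [← key, inv_pow, mul_inv_cancel_right₀ (pow_ne_zero m hb0)]
    rw [hval]
    exact datumStalk_mul_inv_pow_mem b sec (Algebra.adjoin k _).toSubring
      (fun y hy => Algebra.subset_adjoin (Or.inl hy))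
      (fun n hn => Algebra.subset_adjoin (Or.inr ⟨n, hn, rfl⟩)) m hrI
  · -- `im ψ` is a `k`-subalgebra containing the generators
    let T : Subalgebra k K :=
      { carrier := Set.range ψ
        mul_mem' := by
          rintro _ _ ⟨y₁, rfl⟩ ⟨y₂, rfl⟩
          exact ⟨y₁ * y₂, map_mul _ _ _⟩
        one_mem' := ⟨1, map_one _⟩
        add_mem' := by
          rintro _ _ ⟨y₁, rfl⟩ ⟨y₂, rfl⟩
          exact ⟨y₁ + y₂, map_add _ _ _⟩
        zero_mem' := ⟨0, map_zero _⟩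
        algebraMap_mem' := fun c => by
          obtain ⟨r, hr⟩ := hk c
          exact ⟨reesChartBase b hb r, (hψ r).trans hr⟩ }
    have hle :
        Algebra.adjoin k (Set.range sec ∪ {y : K | ∃ n ∈ I, y = sec n * (sec b)⁻¹}) ≤ T := by
      refine Algebra.adjoin_le ?_
      rintro y (⟨r, rfl⟩ | ⟨n, hn, rfl⟩)
      · exact ⟨reesChartBase b hb r, hψ r⟩
      · have hx1 : reesT n hn ∈ reesGrading I (1 • 1) := by simpa using reesT_mem n hn
        have key :=
          datumStalk_apply_awayMk_mul_pow b hb sec ψ hψ hx1 (r := n) (by rw [coe_reesT])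
        rw [pow_one] at key
        refine ⟨HomogeneousLocalization.Away.mk (reesGrading I) (reesT_mem b hb) 1 (reesT n hn) hx1,
          ?_⟩
        rw [← key, mul_inv_cancel_right₀ hb0]
    exact fun y hy => hle hy

end Summit.ResolutionOfSingularities.ResolutionOfSingularities.Theorems.SyzygyFlattening

end
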